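import Summits.ResolutionOfSingularities.ResolutionOfSingularities.Theorems.EquisingularLiftEquisingularLiftNatTowerRoundBDoublePrimeDefs
import HarnessLib

/-!
# T23-A‴ «FIBRE PAIRS» (tier T3 = (F0)+(F1)+(F2)+(F3′), engine word v1.2 FINAL d02b1fbd6b6fb5d2, desk R28) — DOWNSTAIRS STEP PREDICATES
# (text owner res-L1-w45b-lead-2 g6; statement text = res-L1-w45b-stub-4 g11's SIG v2 `L/res-L1-w45b-stub-4/TowerRoundBTriplePrimeSteps.sig.lean` 63338a4ddb1b01c8 VERBATIM):
# (D‴2) `TowerPtRegB₄` / (D‴3) `TowerPtRamB₄` / (D‴4) `TowerRoundBTriplePrime`. The chain closures (D‴5′) `InCarrierReachKSs` / (D‴6) `ReachTowerBTriplePrime` /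
# `ReachNoseTowerBTriplePrime` follow in `…NatTowerReachSsDefs` (plane lineage only: no letters at tier T3).

OURS · L1 W4.5(b) · EL♮(3) stmt-ResolutionOfSingularities-20148 (parent EL♮ stmt-…-20038) · counted 0 · AI-written planning vocabulary, weaker than expert review; nothing of
[Hironaka2017] asserted; NOT a statement of the manuscript. Definitions only (no `sorry`, no instance, no notation; standard axioms).
`--kind definition --supports stmt-ResolutionOfSingularities-20148 --as helper`. Registration mode as T23-A′/A″/A″-S (desk R15/R18/R21″/R24/R26/R28): engine-green swap by the
text owner = the THIRTY-THIRD registration — rung targets⁗ = the B″S rung targets with `ReachTowerBDoublePrimeS ↦ ReachTowerBTriplePrime` /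
`ReachNoseTowerBDoublePrime ↦ ReachNoseTowerBTriplePrime`, compact residue hypothesis `IsoHypDefTowerBTriplePrime` in `…NatResidueHypDefs3`.

WHY (engine word v1/v1.2 §0–§2; (m2) PASS-4 v2 0aca5b2b60034efc §6 = PASS-5 tier table; desk R24/R27/R28). The first certified-outside member of the B″S residue, `x⁴ + y⁶ + z⁹`,
needs a FIBRE pair — a round whose centre `Z = Hst ∩ W` lies over a POINT of the carrier `F₉` — refused by every B″S round through the surjectivity hypothesis
`TowerFull` (dead-curve lemma). Upstairs a fibre pair needs nothing but O-MODELS of host and witness, so the A‴ stage predicate has the arity `R G γ T E Es Ns K` of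
`Tower.InvB₄` (…NatTowerInvBFourDefs p624526): `Es` = MODEL-CARRYING members, `Ns` = MODEL-LESS retained closed sets, the running surface `E` always model-carrying.
POINT STEPS: the menus of res-type-027's upstairs `Tower.invB₄_ptRegStep` / `Tower.invB₄_ptRamStep` (p625638) literally — the B guard `((γ ≫ υ') '' E).Finite`
(= upstairs `Tower.NoRound`) has no discharge under a mandatory model (text owner's Q-E-MENU, stub-4's ruling 2026-08-28T10:36:58Z), so the running surface becomes
the new plane (regular step), or `St E` off the point, or SWITCHES to a retained model-carrying member off the point (shadow dropped); a member through the point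
survives in `Ns` only; the point predicates take `F₁₀` alone (the B binders `F₉ υ'` served the dropped arm). ROUNDS: branches 1–2 VERBATIM under `TowerFull` (now
inside the branch); branch 3 the PAIR round under `TowerFull ∨ hZdim` (= full pair ∪ FIBRE pair, (F0); the centre may lie over a point of the carrier); NEW branch 4
the K-FIBRE round ((F3′): `ConeWitness G E hE K Z hZ` on the running surface, no `DirStepSec`, no dimension clause, `K' = ∅ ∨ K' = St K`); `Es'` by
`RoundTransportOKDoublePrime`; `Ns'` = transports of any member. Upstairs closures written against this text by stub-4 (`Tower.towerPtRegB₄_invB₁_FE` /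
`towerPtRamB₄_invB₁_FE`; round closure‴ over stub-2's cores‴ p625601/p626125/p626174 + RoF‴s). Tier T3 customers (PASS-5 FINAL, candidate, counted 0): x⁴+y⁶+z⁹,
(5,7,9), (6,8,9), (6,9,11), (5,8,11), (7,9,12); letters = A⁗ (desk R28). No formal monotonicity B″S → B‴ (v1 §1); the residue keeps `¬ IsoHypDefTowerBDoublePrimeS` beside
`¬ IsoHypDefTowerBTriplePrime`.
-/

set_option linter.dupNamespace false

noncomputable section

open CategoryTheory CategoryTheory.Limits AlgebraicGeometry TopologicalSpace Topology IsLocalRing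
open Literature.AlgebraicGeometry.Resolution
open AlgebraicGeometry.Scheme.IdealSheafData

namespace Summit.ResolutionOfSingularities.ResolutionOfSingularities.Cruxes.EquisingularLiftNat.Sections

/-- **TOWER-B‴ / (pt-reg)** — `TowerPtRegB` on `(T, K)` with the model-carrying list `Es`, the model-less list `Ns` and the RESTRICTED E-menu of the A‴ engine
word v1 f65b08b6e69a8024 §2 (D‴2) (= res-type-027's `Tower.invB₄_ptRegStep` p625638 as typed): the running surface becomes the NEW PLANE `υ₂⁻¹{y}`, or `St E` when
`y ∉ E`, or SWITCHES to a retained model-carrying member off the point (shadow dropped); `Es'` = away-transports of members of `E :: Es` off the point or the new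
plane (retained WITH its model); `Ns'` = transports of any member (kept model-less, also through the point) or the new plane. [OURS · T23-A‴ Defs; statement text = res-L1-w45b-stub-4 g11 SIG v2 63338a4ddb1b01c8 VERBATIM] -/
def TowerPtRegB₄ (F₁₀ : Scheme.{0})
    (R : ∀ G : Scheme.{0}, (G ⟶ F₁₀) → Set G → Set G → List (Set G) → List (Set G) → Set G → Prop) : Prop :=
  ∀ (G G' : Scheme.{0}) (γ : G ⟶ F₁₀) (T E : Set G) (Es Ns : List (Set G)) (K : Set G) (y : redSub G (closure T) isClosed_closure)
      (υ₂ : G' ⟶ G) (hy : IsClosed ({curvePt G T y} : Set G)) (K' : Set G') (E' : Set G') (Es' Ns' : List (Set G')),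
    R G γ T E Es Ns K →
    ¬ IsRegularLocalRing ((redSub G (closure T) isClosed_closure).presheaf.stalk y) →
    IsRegularLocalRing (G.presheaf.stalk (curvePt G T y)) →
    IsBlowup υ₂ (Scheme.IdealSheafData.vanishingIdeal (⟨{curvePt G T y}, hy⟩ : Closeds G)) →
    (K' = ∅ ∨ (curvePt G T y ∉ closure K ∧ K' = closure (υ₂ ⁻¹' (K \ {curvePt G T y})))) →
    (E' = υ₂ ⁻¹' {curvePt G T y} ∨ (curvePt G T y ∉ E ∧ E' = closure (υ₂ ⁻¹' (E \ {curvePt G T y}))) ∨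
      (∃ F ∈ E :: Es, curvePt G T y ∉ F ∧ E' = closure (υ₂ ⁻¹' (F \ {curvePt G T y})) ∧ K' = ∅)) →
    (∀ F' ∈ Es', (∃ F ∈ E :: Es, curvePt G T y ∉ F ∧ F' = closure (υ₂ ⁻¹' (F \ {curvePt G T y}))) ∨ F' = υ₂ ⁻¹' {curvePt G T y}) →
    (∀ F' ∈ Ns', (∃ F ∈ (E :: Es) ++ Ns, F' = closure (υ₂ ⁻¹' (F \ {curvePt G T y}))) ∨ F' = υ₂ ⁻¹' {curvePt G T y}) →
    R G' (υ₂ ≫ γ) (closure (υ₂ ⁻¹' (T \ {curvePt G T y}))) E' Es' Ns' K'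

/-- **TOWER-B‴ / (pt-ram)** — `TowerPtRamB` with the two lists and the RESTRICTED E-menu (D‴3) (= res-type-027's `Tower.invB₄_ptRamStep` as typed): the FAT
plane `υ₂⁻¹{y}` may enter `Ns'` only; the running surface is `St E` off the point or switches to a retained model-carrying member off the point (shadow dropped);
`Es'` = away-transports only. Downstairs-visible: a ramified point lying on `E` and on every member of `Es` ends the chain. [OURS · T23-A‴ Defs; statement text = res-L1-w45b-stub-4 g11 SIG v2 63338a4ddb1b01c8 VERBATIM] -/
def TowerPtRamB₄ (F₁₀ : Scheme.{0})
    (R : ∀ G : Scheme.{0}, (G ⟶ F₁₀) → Set G → Set G → List (Set G) → List (Set G) → Set G → Prop) : Prop :=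
  ∀ (G G' : Scheme.{0}) (γ : G ⟶ F₁₀) (T E : Set G) (Es Ns : List (Set G)) (K : Set G) (y : redSub G (closure T) isClosed_closure)
      (J : G.IdealSheafData) (υ₂ : G' ⟶ G) (K' : Set G') (E' : Set G') (Es' Ns' : List (Set G')),
    R G γ T E Es Ns K →
    ¬ IsRegularLocalRing ((redSub G (closure T) isClosed_closure).presheaf.stalk y) →
    ¬ IsRegularLocalRing (G.presheaf.stalk (curvePt G T y)) →
    (J.support : Set G) = {curvePt G T y} →
    (∃ (ℓ : Fin 3 → G.presheaf.stalk (curvePt G T y)) (hℓ : ∀ i, ℓ i ∈ IsLocalRing.maximalIdeal (G.presheaf.stalk (curvePt G T y))),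
      stalkIdeal J (curvePt G T y) = Ideal.span (Set.range ℓ) ∧
      LinearIndependent (IsLocalRing.ResidueField (G.presheaf.stalk (curvePt G T y)))
        (fun i => (IsLocalRing.maximalIdeal (G.presheaf.stalk (curvePt G T y))).toCotangent ⟨ℓ i, hℓ i⟩)) →
    IsBlowup υ₂ J →
    (K' = ∅ ∨ (curvePt G T y ∉ closure K ∧ K' = closure (υ₂ ⁻¹' (K \ {curvePt G T y})))) →
    ((curvePt G T y ∉ E ∧ E' = closure (υ₂ ⁻¹' (E \ {curvePt G T y}))) ∨
      (∃ F ∈ E :: Es, curvePt G T y ∉ F ∧ E' = closure (υ₂ ⁻¹' (F \ {curvePt G T y})) ∧ K' = ∅)) →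
    (∀ F' ∈ Es', ∃ F ∈ E :: Es, curvePt G T y ∉ F ∧ F' = closure (υ₂ ⁻¹' (F \ {curvePt G T y}))) →
    (∀ F' ∈ Ns', (∃ F ∈ (E :: Es) ++ Ns, F' = closure (υ₂ ⁻¹' (F \ {curvePt G T y}))) ∨ F' = υ₂ ⁻¹' {curvePt G T y}) →
    R G' (υ₂ ≫ γ) (closure (υ₂ ⁻¹' (T \ {curvePt G T y}))) E' Es' Ns' K'

/-- **TOWER-B‴ / (round)** — `TowerRoundBDoublePrime` with the two lists, `TowerFull` MOVED INTO the hosting branches, and two new FIBRE branches (engine word v1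
§2 (D‴4)): branches 1–2 VERBATIM under `TowerFull`; branch 3 the PAIR ROUND under `TowerFull` OR — NEW, the FIBRE PAIR — under `hZdim` («`Z̃` is a curve at its
closed points»; the centre may lie over a point of the carrier); NEW branch 4 the K-FIBRE round: the shadow-witnessed round on the running surface (`ConeWitness G E hE
K Z hZ`) WITHOUT `DirStepSec` and without any dimension clause (res-L1-w45b-stub-2's cone RoF‴ needs none). `Es'` by `RoundTransportOKDoublePrime` from `E :: Es`; `Ns'` = transports of any member (model-less).
[OURS · T23-A‴ Defs; statement text = res-L1-w45b-stub-4 g11 SIG v2 63338a4ddb1b01c8 VERBATIM] -/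
def TowerRoundBTriplePrime (F₉ F₁₀ : Scheme.{0}) (υ' : F₁₀ ⟶ F₉) (Z₉ : Set F₉) (hZ₉ : IsClosed Z₉)
    (R : ∀ G : Scheme.{0}, (G ⟶ F₁₀) → Set G → Set G → List (Set G) → List (Set G) → Set G → Prop) : Prop :=
  ∀ (G G' : Scheme.{0}) (γ : G ⟶ F₁₀) (T E : Set G) (Es Ns : List (Set G)) (K : Set G) (hE : IsClosed E) (Z : Set G) (hZ : IsClosed Z)
      (Hst W : Set G) (υ₂ : G' ⟶ G) (K' : Set G') (E' : Set G') (Es' Ns' : List (Set G')),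
    R G γ T E Es Ns K →
    Z ⊆ T → Z.Nonempty →
    ((TowerFull F₉ F₁₀ υ' Z₉ hZ₉ G γ Z hZ ∧ W = Hst ∧ Hst = E ∧ Z ⊆ E ∧
        ((DirStepSec F₉ F₁₀ υ' Z₉ hZ₉ G γ Z hZ ∧
            ((RationalCarrier (redSub F₉ Z₉ hZ₉) ∧
                (∀ x : redSub G Z hZ, IsRegularLocalRing (G.presheaf.stalk (redSubι G Z hZ x))) ∧
                (∀ (i : redSub G Z hZ ⟶ redSub G E hE), i ≫ redSubι G E hE = redSubι G Z hZ →
                  ∀ x : redSub G Z hZ, IsRegularLocalRing ((redSub G E hE).presheaf.stalk (i x))) ∧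
                DirStepUnobs G E hE Z hZ) ∨
              ConeWitness G E hE K Z hZ)) ∨
          (IsIrreducible Z ∧ (∀ x : redSub G Z hZ, IsRegularLocalRing ((redSub G Z hZ).presheaf.stalk x)) ∧
            (∀ x : redSub G Z hZ, IsRegularLocalRing (G.presheaf.stalk (redSubι G Z hZ x))) ∧
            (∀ (i : redSub G Z hZ ⟶ redSub G E hE), i ≫ redSubι G E hE = redSubι G Z hZ →
              ∀ x : redSub G Z hZ, IsRegularLocalRing ((redSub G E hE).presheaf.stalk (i x))) ∧
            DirStepUnobs G E hE Z hZ)) ∧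
        (E' = υ₂ ⁻¹' Z ∨ E' = closure (υ₂ ⁻¹' (E \ Z))) ∧
        (K' = ∅ ∨ ((ConeWitness G E hE K Z hZ ∨ closure (Z \ closure K) = Z) ∧ K' = closure (υ₂ ⁻¹' (K \ Z))))) ∨
      (TowerFull F₉ F₁₀ υ' Z₉ hZ₉ G γ Z hZ ∧ W = Hst ∧ Hst ∈ Es ∧ ∃ hF : IsClosed Hst, Z ⊆ Hst ∧ IsIrreducible Z ∧
        (∀ x : redSub G Z hZ, IsRegularLocalRing ((redSub G Z hZ).presheaf.stalk x)) ∧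
        (∀ x : redSub G Z hZ, IsRegularLocalRing (G.presheaf.stalk (redSubι G Z hZ x))) ∧
        (∀ (i : redSub G Z hZ ⟶ redSub G Hst hF), i ≫ redSubι G Hst hF = redSubι G Z hZ →
          ∀ x : redSub G Z hZ, IsRegularLocalRing ((redSub G Hst hF).presheaf.stalk (i x))) ∧
        DirStepUnobs G Hst hF Z hZ ∧
        E' = υ₂ ⁻¹' Z ∧
        (K' = ∅ ∨ (Disjoint Z (closure K) ∧ K' = closure (υ₂ ⁻¹' (K \ Z))))) ∨
      -- the PAIR ROUND (T23-A″), FULL (`TowerFull`) or — NEW (T23-A‴) — FIBRE (`hZdim`): centre = the reduced crossing curve of two model-carrying members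
      ((TowerFull F₉ F₁₀ υ' Z₉ hZ₉ G γ Z hZ ∨
          ∀ z : ↥(redSub G Z hZ), IsClosed ({z} : Set ↥(redSub G Z hZ)) → ringKrullDim ((redSub G Z hZ).presheaf.stalk z) = ((1 : ℕ) : WithBot ℕ∞)) ∧
        Hst ∈ E :: Es ∧ W ∈ E :: Es ∧ Hst ≠ W ∧ ∃ (hH : IsClosed Hst) (_hW : IsClosed W),
        ConeWitness G Hst hH W Z hZ ∧
        (∀ x : redSub G Z hZ, IsRegularLocalRing ((redSub G Z hZ).presheaf.stalk x)) ∧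
        E' = υ₂ ⁻¹' Z ∧
        (K' = ∅ ∨ ((((Hst = E ∨ W = E) ∧ closure (Z \ closure K) = Z) ∨ Disjoint Z (closure K)) ∧
          K' = closure (υ₂ ⁻¹' (K \ Z))))) ∨
      -- NEW (T23-A‴): the K-FIBRE round — the shadow-witnessed round on the running surface, no `DirStepSec`, no dimension clause (full or fibre alike)
      (W = Hst ∧ Hst = E ∧ Z ⊆ E ∧ ConeWitness G E hE K Z hZ ∧
        (E' = υ₂ ⁻¹' Z ∨ E' = closure (υ₂ ⁻¹' (E \ Z))) ∧
        (K' = ∅ ∨ K' = closure (υ₂ ⁻¹' (K \ Z))))) →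
    IsBlowup υ₂ (Scheme.IdealSheafData.vanishingIdeal (⟨Z, hZ⟩ : Closeds G)) →
    (∀ F' ∈ Es', ∃ F ∈ E :: Es, RoundTransportOKDoublePrime υ₂ Z hZ Hst W F F') →
    (∀ F' ∈ Ns', ∃ F ∈ (E :: Es) ++ Ns, F' = closure (υ₂ ⁻¹' (F \ Z))) →
    R G' (υ₂ ≫ γ) (closure (υ₂ ⁻¹' (T \ Z))) E' Es' Ns' K'

end Summit.ResolutionOfSingularities.ResolutionOfSingularities.Cruxes.EquisingularLiftNat.Sections

end
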